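import Mathlib
import HarnessLib
import Summits.NavierStokesRegularity.NavierStokesRegularity.Theorems.PoloidalWindowDoorLrcModEntireHigherOrderMaxTest
import Summits.NavierStokesRegularity.NavierStokesRegularity.Theorems.PoloidalWindowDoorLrcModEntireTwistingTHJetStructure
import Summits.NavierStokesRegularity.NavierStokesRegularity.Theorems.PoloidalWindowDoorLrcModEntireTwistingTHJetEndgame

/-!
# Item `LrcModEntire` (stmt-NavierStokesRegularity-20428), skeleton twist_split v6 — T1 cell, step (I), JET stub: (Z) ORDERS, SIGNS and (F1) BOUNDS of the z-jets

Cell ns-regularity-ideate, seat ns-k2-port-2 g4 (free hand; `--supports stmt-NavierStokesRegularity-20428 --as helper`).  Sub-step (Z) of `stub_flatPlane_badData`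
(LEAD ns-poloidal-K2-p3 g13, `Cruxes/LrcModEntire/T1StepI.lean`, CELLS-TH-g13 §2ter), CLASS-FREE, in the setting of `…TwistingTHJetStructure` (analytic `u : ℝ³ → ℝ³`,
planar embedding `ι`, jets `B k`, `A j` by defining hypotheses):

* `exists_jetB_ne` — if `u₂ ≡ N` on the plane but `u₂ ≢ N` somewhere, SOME vertical jet `B k`, `k ≥ 1`, is not identically zero (a flat entire analytic function
  of `z` is constant — `…TwistingTHJetTools.eq_of_iteratedDeriv_eq_zero`);
* `jetB_nonpos_of_max` / `jetB_nonneg_of_min` — the SIGN PIN: `u₂ ≤ N` everywhere (resp. `≥`) and `B k ≡ 0` for `1 ≤ k < k₀` ⇒ `B k₀ ≤ 0` (resp. `≥ 0`)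
  [`…HigherOrderMaxTest.higherOrderMaxTest_nonpos` on the line function `z ↦ u₂(ι x + z e₂)`];
* `abs_jetB_le`, `norm_jetA_le` — (F1) `sup‖Dᵏu‖ < ∞` ⇒ the jets are bounded;
* `badData_of_planarJets_nonneg` — the sign-flipped companion of `…TwistingTHJetEndgame.badData_of_planarJets` (`b ≥ 0`: apply it to `(−a', −b, −a)`).

WHAT THIS IS NOT: not a claim about Navier–Stokes regularity — generic jet calculus for the T1 cell (bears_on LADDER-NS N0, item 20428 / crux 19708; both OPEN).
-/

noncomputable section

-- the summit and its single sub-problem share the name (CONVENTIONS §1), as in every Theorems file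
set_option linter.dupNamespace false

namespace Summit.NavierStokesRegularity.NavierStokesRegularity.Theorems.PoloidalWindowDoorLrcModEntireTwistingTHJetOrders

open Set Function Filter Topology InnerProductSpace
open scoped Topology ContDiff RealInnerProductSpace InnerProductSpace Laplacian
open Summit.NavierStokesRegularity.NavierStokesRegularity.Theorems.PoloidalWindowDoorLrcModEntireTwistingTHJetTools
open Summit.NavierStokesRegularity.NavierStokesRegularity.Theorems.PoloidalWindowDoorLrcModEntireTwistingTHJetStructure
open Summit.NavierStokesRegularity.NavierStokesRegularity.Theorems.PoloidalWindowDoorLrcModEntireTwistingTHJetEndgame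
open Summit.NavierStokesRegularity.NavierStokesRegularity.Theorems.PoloidalWindowDoorLrcModEntireHigherOrderMaxTest

section Jets

variable {u : EuclideanSpace ℝ (Fin 3) → EuclideanSpace ℝ (Fin 3)} {ι : EuclideanSpace ℝ (Fin 2) →L[ℝ] EuclideanSpace ℝ (Fin 3)}
  {B : ℕ → EuclideanSpace ℝ (Fin 2) → ℝ} {A : ℕ → EuclideanSpace ℝ (Fin 2) → EuclideanSpace ℝ (Fin 2)}

/-- Every point of `ℝ³` lies on the vertical line through a point of the plane: `y = ι x + y₂ e₂`. -/
theorem exists_embed_add (hι0 : ∀ x, ι x 0 = x 0) (hι1 : ∀ x, ι x 1 = x 1) (hι2 : ∀ x, ι x 2 = 0) (y : EuclideanSpace ℝ (Fin 3)) :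
    ∃ x : EuclideanSpace ℝ (Fin 2), ι x + (y 2) • EuclideanSpace.single (2 : Fin 3) (1 : ℝ) = y := by
  refine ⟨(EuclideanSpace.equiv (Fin 2) ℝ).symm ![y 0, y 1], ?_⟩
  ext i
  fin_cases i <;> simp [hι0, hι1, hι2]

/-- The line function `z ↦ u₂(ι x + z e₂)`: smooth, and its `z`-derivatives at `0` are the jets `B k x`. -/
theorem line_facts (hu : AnalyticOnNhd ℝ u univ)
    (hB : ∀ k x, B k x = iteratedFDeriv ℝ k (fun y => u y 2) (ι x) (fun _ => EuclideanSpace.single (2 : Fin 3) (1 : ℝ))) (x : EuclideanSpace ℝ (Fin 2)) :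
    AnalyticOnNhd ℝ (fun z : ℝ => u (ι x + z • EuclideanSpace.single (2 : Fin 3) (1 : ℝ)) 2) univ ∧
      (∀ n : ℕ, ContDiff ℝ n (fun z : ℝ => u (ι x + z • EuclideanSpace.single (2 : Fin 3) (1 : ℝ)) 2)) ∧
      ∀ k, iteratedDeriv k (fun z : ℝ => u (ι x + z • EuclideanSpace.single (2 : Fin 3) (1 : ℝ)) 2) 0 = B k x := by
  have hf := analyticOnNhd_coord hu 2
  have han := analyticOnNhd_lineRestrict hf (ι x) (EuclideanSpace.single (2 : Fin 3) (1 : ℝ))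
  refine ⟨han, fun n => han.contDiff, fun k => ?_⟩
  rw [iteratedDeriv_lineRestrict hf.contDiff (ι x) _ (m := k) (N := ω) le_top 0, hB]
  simp

/-- **(Z) existence of a non-trivial vertical jet.**  `u₂ ≡ N` on the plane and `u₂(y) ≠ N` for some `y` ⇒ `B k x ≠ 0` for some `k ≥ 1`, `x`. -/
theorem exists_jetB_ne (hu : AnalyticOnNhd ℝ u univ) (hι0 : ∀ x, ι x 0 = x 0) (hι1 : ∀ x, ι x 1 = x 1) (hι2 : ∀ x, ι x 2 = 0)
    (hB : ∀ k x, B k x = iteratedFDeriv ℝ k (fun y => u y 2) (ι x) (fun _ => EuclideanSpace.single (2 : Fin 3) (1 : ℝ))) {N : ℝ}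
    (hB0 : ∀ x, B 0 x = N) (hnf : ∃ y, u y 2 ≠ N) : ∃ k, 1 ≤ k ∧ ∃ x, B k x ≠ 0 := by
  by_contra h
  push Not at h
  obtain ⟨y, hy⟩ := hnf
  obtain ⟨x, hx⟩ := exists_embed_add hι0 hι1 hι2 y
  obtain ⟨han, -, hder⟩ := line_facts hu hB x
  have hconst := eq_of_iteratedDeriv_eq_zero han (z₀ := 0) (fun k hk => by rw [hder]; exact h k hk x) (y 2)
  rw [hx] at hconst
  have h0 : u (ι x + (0 : ℝ) • EuclideanSpace.single (2 : Fin 3) (1 : ℝ)) 2 = N := by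
    have := hder 0
    rw [iteratedDeriv_zero] at this
    rw [this, hB0]
  exact hy (hconst.trans h0)

/-- **(Z) sign pin at a maximum plane**: `u₂ ≤ N` on `ℝ³`, `u₂ ≡ N` on the plane, `B k ≡ 0` for `1 ≤ k < k₀` (`k₀ ≥ 1`) ⇒ `B k₀ ≤ 0`. -/
theorem jetB_nonpos_of_max (hu : AnalyticOnNhd ℝ u univ)
    (hB : ∀ k x, B k x = iteratedFDeriv ℝ k (fun y => u y 2) (ι x) (fun _ => EuclideanSpace.single (2 : Fin 3) (1 : ℝ))) {N : ℝ}
    (hB0 : ∀ x, B 0 x = N) (hmax : ∀ y, u y 2 ≤ N) {k₀ : ℕ} (hk₀ : 1 ≤ k₀) (hBvan : ∀ k, 1 ≤ k → k < k₀ → ∀ x, B k x = 0)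
    (x : EuclideanSpace ℝ (Fin 2)) : B k₀ x ≤ 0 := by
  obtain ⟨-, hC, hder⟩ := line_facts hu hB x
  have h0 : u (ι x + (0 : ℝ) • EuclideanSpace.single (2 : Fin 3) (1 : ℝ)) 2 = N := by
    have := hder 0; rw [iteratedDeriv_zero] at this; rw [this, hB0]
  have hlm : IsLocalMax (fun z : ℝ => u (ι x + z • EuclideanSpace.single (2 : Fin 3) (1 : ℝ)) 2) 0 :=
    Filter.Eventually.of_forall fun z => by
      show u (ι x + z • EuclideanSpace.single (2 : Fin 3) (1 : ℝ)) 2 ≤ u (ι x + (0 : ℝ) • EuclideanSpace.single (2 : Fin 3) (1 : ℝ)) 2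
      rw [h0]; exact hmax _
  rw [← hder k₀]
  exact higherOrderMaxTest_nonpos (hC k₀) hk₀ hlm fun k hk1 hk2 => by rw [hder]; exact hBvan k hk1 hk2 x

/-- **(Z) sign pin at a minimum plane**: `u₂ ≥ N` on `ℝ³`, `u₂ ≡ N` on the plane, `B k ≡ 0` for `1 ≤ k < k₀` (`k₀ ≥ 1`) ⇒ `B k₀ ≥ 0`. -/
theorem jetB_nonneg_of_min (hu : AnalyticOnNhd ℝ u univ)
    (hB : ∀ k x, B k x = iteratedFDeriv ℝ k (fun y => u y 2) (ι x) (fun _ => EuclideanSpace.single (2 : Fin 3) (1 : ℝ))) {N : ℝ}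
    (hB0 : ∀ x, B 0 x = N) (hmin : ∀ y, N ≤ u y 2) {k₀ : ℕ} (hk₀ : 1 ≤ k₀) (hBvan : ∀ k, 1 ≤ k → k < k₀ → ∀ x, B k x = 0)
    (x : EuclideanSpace ℝ (Fin 2)) : 0 ≤ B k₀ x := by
  obtain ⟨-, hC, hder⟩ := line_facts hu hB x
  have h0 : u (ι x + (0 : ℝ) • EuclideanSpace.single (2 : Fin 3) (1 : ℝ)) 2 = N := by
    have := hder 0; rw [iteratedDeriv_zero] at this; rw [this, hB0]
  set φ : ℝ → ℝ := fun z => u (ι x + z • EuclideanSpace.single (2 : Fin 3) (1 : ℝ)) 2 with hφ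
  have hlm : IsLocalMax (-φ) 0 := Filter.Eventually.of_forall fun z => by
    show -(u (ι x + z • EuclideanSpace.single (2 : Fin 3) (1 : ℝ)) 2) ≤ -(u (ι x + (0 : ℝ) • EuclideanSpace.single (2 : Fin 3) (1 : ℝ)) 2)
    rw [h0, neg_le_neg_iff]; exact hmin _
  have hCn : ContDiff ℝ k₀ (-φ) := (hC k₀).neg
  have h := higherOrderMaxTest_nonpos hCn hk₀ hlm fun k hk1 hk2 => by
    rw [iteratedDeriv_neg, hder, hBvan k hk1 hk2 x, neg_zero]
  rw [iteratedDeriv_neg, hder] at h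
  linarith

/-- **(F1) bound for the vertical jets**: `‖Dᵏu‖ ≤ K` on `ℝ³` ⇒ `|B k| ≤ K`. -/
theorem abs_jetB_le (hu : AnalyticOnNhd ℝ u univ)
    (hB : ∀ k x, B k x = iteratedFDeriv ℝ k (fun y => u y 2) (ι x) (fun _ => EuclideanSpace.single (2 : Fin 3) (1 : ℝ))) (k : ℕ) {K : ℝ}
    (hK : ∀ y, ‖iteratedFDeriv ℝ k u y‖ ≤ K) (x : EuclideanSpace ℝ (Fin 2)) : |B k x| ≤ K := by
  rw [hB, iteratedFDeriv_coord (hu.contDiff (n := ω)) 2 (ι x) (m := k) le_top, ← Real.norm_eq_abs]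
  refine (PiLp.norm_apply_le _ 2).trans (((iteratedFDeriv ℝ k u (ι x)).le_opNorm _).trans ?_)
  have h1 : ∏ _i : Fin k, ‖(EuclideanSpace.single (2 : Fin 3) (1 : ℝ))‖ = 1 := by simp
  rw [h1, mul_one]
  exact hK _

/-- A planar vector is bounded by the sum of its coordinates' absolute values. -/
theorem norm_le_abs_add_abs (a : EuclideanSpace ℝ (Fin 2)) : ‖a‖ ≤ |a 0| + |a 1| := by
  conv_lhs => rw [planar_expand a]
  refine (norm_add_le _ _).trans ?_
  simp [norm_smul]

/-- **(F1) bound for the horizontal jets**: `‖Dʲ⁺¹u‖ ≤ K` on `ℝ³` ⇒ `‖A j‖ ≤ 2K`. -/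
theorem norm_jetA_le (hu : AnalyticOnNhd ℝ u univ)
    (hA : ∀ j x (i : Fin 2), A j x i = iteratedFDeriv ℝ (j + 1) (fun y => u y (Fin.castSucc i)) (ι x) (fun _ => EuclideanSpace.single (2 : Fin 3) (1 : ℝ)))
    (j : ℕ) {K : ℝ} (hK : ∀ y, ‖iteratedFDeriv ℝ (j + 1) u y‖ ≤ K) (x : EuclideanSpace ℝ (Fin 2)) : ‖A j x‖ ≤ 2 * K := by
  have hc : ∀ i : Fin 2, |A j x i| ≤ K := by
    intro i
    rw [hA, iteratedFDeriv_coord (hu.contDiff (n := ω)) _ (ι x) (m := j + 1) le_top, ← Real.norm_eq_abs]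
    refine (PiLp.norm_apply_le _ _).trans (((iteratedFDeriv ℝ (j + 1) u (ι x)).le_opNorm _).trans ?_)
    have h1 : ∏ _i : Fin (j + 1), ‖(EuclideanSpace.single (2 : Fin 3) (1 : ℝ))‖ = 1 := by simp
    rw [h1, mul_one]
    exact hK _
  linarith [norm_le_abs_add_abs (A j x), hc 0, hc 1]

end Jets

/-! ### The sign-flipped endgame -/

/-- **LOWEST JETS ⇒ BAD DATA, `b ≥ 0` version** (apply `badData_of_planarJets` to `(−a', −b, −a)`). -/
theorem badData_of_planarJets_nonneg {a a' : EuclideanSpace ℝ (Fin 2) → EuclideanSpace ℝ (Fin 2)} {b : EuclideanSpace ℝ (Fin 2) → ℝ} {G B : ℝ}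
    (ha' : ContDiff ℝ 3 a')
    (hcurl' : ∀ x, fderiv ℝ a' x (EuclideanSpace.single 0 1) 1 = fderiv ℝ a' x (EuclideanSpace.single 1 1) 0)
    (hdiv' : ∀ x, fderiv ℝ a' x (EuclideanSpace.single 0 1) 0 + fderiv ℝ a' x (EuclideanSpace.single 1 1) 1 = -b x)
    (hG : ∀ x, ‖a' x‖ ≤ G) (hb_ge : ∀ x, 0 ≤ b x) (hb_ne : ∃ x, b x ≠ 0) (hB : ∀ x, |b x| ≤ B)
    (ha : ContDiff ℝ 1 a) (hane : ∃ x, a x ≠ 0)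
    (hlink : a = a' ∨ ∀ x, fderiv ℝ a x (EuclideanSpace.single 0 1) 0 + fderiv ℝ a x (EuclideanSpace.single 1 1) 1 = 0)
    (hTH : ∀ (x x' : EuclideanSpace ℝ (Fin 2)) (i l : Fin 2),
      a x i * fderiv ℝ b x' (EuclideanSpace.single l 1) = a x' l * fderiv ℝ b x (EuclideanSpace.single i 1)) :
    ∃ Φ : EuclideanSpace ℝ (Fin 3) → ℝ, ContDiff ℝ 3 Φ ∧ (∃ G : ℝ, ∀ x, ‖fderiv ℝ Φ x‖ ≤ G) ∧ (∀ x, 0 ≤ (Δ Φ) x) ∧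
      (∃ x, (Δ Φ) x ≠ 0) ∧
      ((∃ L : EuclideanSpace ℝ (Fin 3) →L[ℝ] ℝ, ∀ x, fderiv ℝ (Δ Φ) x = L) ∨
        (∃ μ₀ : ℝ, ∀ x, fderiv ℝ Φ x = (-μ₀) • fderiv ℝ (Δ Φ) x)) := by
  have hfa' : ∀ x, fderiv ℝ (fun y => -a' y) x = -fderiv ℝ a' x := fun x => fderiv_fun_neg
  have hfa : ∀ x, fderiv ℝ (fun y => -a y) x = -fderiv ℝ a x := fun x => fderiv_fun_neg
  have hfb : ∀ x, fderiv ℝ (fun y => -b y) x = -fderiv ℝ b x := fun x => fderiv_fun_neg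
  refine badData_of_planarJets (a := fun y => -a y) (a' := fun y => -a' y) (b := fun y => -b y) (G := G) (B := B) ha'.neg
    (fun x => ?_) (fun x => ?_) (fun x => by rw [norm_neg]; exact hG x) (fun x => by linarith [hb_ge x])
    (by obtain ⟨x, hx⟩ := hb_ne; exact ⟨x, neg_ne_zero.mpr hx⟩) (fun x => by rw [abs_neg]; exact hB x) ha.neg
    (by obtain ⟨x, hx⟩ := hane; exact ⟨x, neg_ne_zero.mpr hx⟩) ?_ (fun x x' i l => ?_)
  · rw [hfa']; simp only [neg_apply, PiLp.neg_apply]; rw [hcurl' x]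
  · rw [hfa']; simp only [neg_apply, PiLp.neg_apply]; linarith [hdiv' x]
  · rcases hlink with rfl | hdiv
    · exact Or.inl rfl
    · refine Or.inr fun x => ?_
      rw [hfa]; simp only [neg_apply, PiLp.neg_apply]; linarith [hdiv x]
  · rw [hfb, hfb]
    simp only [neg_apply, PiLp.neg_apply]
    linarith [hTH x x' i l]

end Summit.NavierStokesRegularity.NavierStokesRegularity.Theorems.PoloidalWindowDoorLrcModEntireTwistingTHJetOrders
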